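import Mathlib.Analysis.SpecialFunctions.Trigonometric.Basic
import Literature.Computability.QuantumComplexity.StabilizerRank
import Literature.Computability.Cryptography.QuantumCircuit
import Literature.Computability.Cryptography.ClassBQP
import Literature.Computability.Cryptography.TCount
import Literature.Computability.Complexity.Randomized
import Literature.Algebra.EuclideanLattices.Encoding
import HarnessLib

/-!
# Stabilizer-rank simulation of Clifford+`T` circuits (Bravyi–Smith–Smolin, Bravyi–Gosset, BBCCGH)

Trunk T-CPLX-QUANT (`Literature/Computability/QuantumComplexity`); named facts requested by the
route `QuantumAdvantage/Dequantize` (crux #2, work item `wi-03602`), over the definitions of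
`StabilizerRank.lean` (`stabilizerStates`, `stabilizerRank = χ`, `approxStabilizerRank = χ_δ`,
`magicT = |T⟩`, `tensorPow`), the circuit model of `QuantumCircuit.lean` (`QCircuit cliffordT`,
`toMatrix`, `acceptProb`, `sigmaEncode`), the `T`-count of `TCount.lean` and the randomized
algorithms of `Randomized.lean` (`RandAlg`, `RunsInTime`, `pr`).

## The facts (all `def … : Prop`, none discharged here)

Rank bounds (pure linear algebra over the tree's definitions):

* `BravyiEtAl2019_thm1` — **sparsification** (BBCCGH 2019, Thm. 1): a normalized `ψ = ∑ c_α φ_α`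
  with normalized stabilizer states `φ_α` has `χ_δ(ψ) ≤ 1 + ‖c‖₁² / δ²`.
* `BravyiEtAl2019_approxStabilizerRank_magicT_pow` — `χ_δ(|T⟩^{⊗m}) ≤ 1 + cos(π/8)^{-2m} / δ²`
  (BBCCGH 2019, Thm. 1 with the optimal decomposition of §5.3, `F(T^{⊗m}) = |⟨+|T⟩|^{2m}`,
  Prop. 2 `ξ = F⁻¹`; printed as eq. (6) `χ_δ(T^{⊗m}) ≤ O(δ^{-2} cos(π/8)^{-2m})`; Bravyi–Gosset
  2016, eq. (4): `γ = -2 log₂ cos(π/8) ≈ 0.228`).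
* `BravyiSmithSmolin2016_stabilizerRank_magicT_pow_six` — `χ(|T⟩^{⊗6}) ≤ 7` (BSS 2016, §I and
  §IV eq. (11), the explicit seven-term decomposition of `|H⟩^{⊗6}`, `|H⟩` Clifford-equivalent
  to `|T⟩`), and `…_pow_six_mul` — `χ(|T⟩^{⊗6m}) ≤ 7^m` (BSS 2016, §I: "`χ₆ ≤ 7` which implies
  `χ_n ≤ (χ₆)^{n/6} ≤ 7^{n/6}`"; Bravyi–Gosset 2016, p. 2: `β = (1/6) log₂ 7 ≈ 0.47`).
* `BravyiSmithSmolin2016_stabilizerRank_tensorVec_le` — sub-multiplicativity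
  `χ(ψ ⊗ φ) ≤ χ(ψ) χ(φ)` (BSS 2016, §IV eq. (9): tensor products of stabilizer decompositions).
* `BravyiGosset2016_stabilizerRank_output_le` — **gadgetization**: for an oracle-free Clifford+`T`
  circuit `U` with `t` `T`-gates and a basis state `|y⟩`, `χ(U|y⟩) ≤ χ(|T⟩^{⊗t})`
  (BBCCGH 2019, §2.3.1 eq. (16); Bravyi–Gosset 2016, §II).

Simulation algorithm (over `RandAlg`/`RunsInTime`):

* `BravyiGosset2016_estimateAcceptProb` — Bravyi–Gosset's first result (2016, p. 1–2, eq. (2)),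
  in the instance `w = 1` (output register = wire `0`), failure probability `p_f = 1/4`, `β = 1/2`:
  a classical randomized algorithm which, given a Clifford+`T` circuit `U` on `n + m` wires with
  `t` `T`-gates, an input `x ∈ {0,1}^n` and a precision `q` (relative error `ε = 1/(q+1)`),
  outputs with probability `≥ 3/4` a number `p̂` with `|p̂ - P| ≤ ε P`, `P` the wire-`0`
  acceptance probability of `U |x 0^m⟩` (`QCircuit.acceptProb`), in time
  `poly(n + m, |U|, q) · 2^{⌈t/2⌉}` (printed: `O((w+t)(c+t) + (n+t)³ + 2^{βt} t³ ε^{-2} log p_f⁻¹)`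
  with "`β ≤ 1/2` a constant that depends on the implementation details"; the polynomial and the
  exponent `⌈t/2⌉ ≥ t/2` are implied by, and weaker than, the printed bound).

## What is *not* vendored, and why

The requesting item asks for the "`χ`-parametric" form: *given* a `δ`-approximate stabilizer
decomposition of `|T⟩^{⊗t}` with `χ` terms, estimate the acceptance probability to additive error
`O(δ) + ε` in time `poly(n, m, χ, 1/ε)`. Neither source prints this as a theorem with a definite
input model: (i) BBCCGH 2019, §2.3.1, state that the random-sample gadget method (the one that
tolerates *approximate* decompositions) "allows one to sample from a probability distribution
which approximates `P_U` but … in general cannot be used to obtain an accurate estimate of an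
individual output probability", while the fixed-sample method needs an *exact* decomposition
(error amplification `2^{t/2} δ`); (ii) a uniform running time `poly(χ)` requires the
decomposition (Clifford circuits and algebraic coefficients) as encoded input, and the tree has no
encoding of stabilizer decompositions — a definition item (`defn-StabilizerDecompositionCode`)
should precede such a fact. What the sources do print, and what is recorded here, is the rank
inequality behind the `χ`-parametric principle (`…_stabilizerRank_output_le`), the rank bounds
that make it quantitative, and the fully specified uniform algorithm of Bravyi–Gosset (`β = 1/2`).
Bravyi–Gosset's second result (sampling `w` output bits `ε`-close in `L¹`, time
`Õ(… + 2^{γt} t³ w³ ε^{-O(1)})`) is likewise not vendored here (it needs the output-distribution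
kernel of a `RandAlg`, a small further definition).

## Mathlib / tree reuse

`Real.cos`, `Real.pi`, `Matrix.mulVec`, finite sums; tree: `stabilizerRank`,
`approxStabilizerRank`, `stabilizerStates`, `magicT`, `tensorPow`, `tensorVec`, `normSq`,
`basisState`, `QCircuit.toMatrix/acceptProb/size/IsOracleFree/sigmaEncode`, `QCircuit.tCount`,
`RandAlg.RunsInTime/pr`, `boolPair`, `unaryEncodeNat`, `encodeRat`, the `Encodable cliffordT.Op`
instance of `ClassBQP.lean`. Mathlib has no stabilizer
formalism (see `StabilizerRank.lean`).

## Design choices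

* Instances of the simulation problem are a small structure `CliffordTInstance` (wires `n + m`,
  circuit, classical input `x`, precision `q`), encoded by `boolPair`ing the tree's encoders
  (`sigmaEncode` for the circuit, the raw bit list for `x`, *unary* `q` so that `1/ε` counts
  towards the input length, as in "time `poly(1/ε)`").
* The output estimate is a rational number (`encodeRat`); Bravyi–Gosset's estimator is an average
  of squared stabilizer inner products (algebraic numbers), and rounding it to a rational within
  half the target error is a harmless post-processing.
* Relative error is written multiplicatively, `|p̂ - P| ≤ P/(q+1)`, no division by `P`.
* The oracle argument of `toMatrix`/`acceptProb` is irrelevant for oracle-free circuits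
  (`QCircuit.toMatrix_eq_of_isOracleFree`); we pass `0` as `BQP` does, resp. quantify over it.
* `…_output_le` is stated for an arbitrary basis-state input `|y⟩` rather than `|0ⁿ⟩`:
  `|y⟩ = ∏ X_i |0ⁿ⟩` with `X = H S² H` Clifford, so `U|y⟩ = U'|0ⁿ⟩` for a Clifford+`T` circuit
  `U'` of the same `T`-count, which is the printed case. BBCCGH write "`χ(U|0ⁿ⟩) = χ(Ψ)`"; only
  `≤` follows from eq. (16) (and `=` fails, e.g. for `U = T⁸ = 1`), so `≤` is what is recorded.

## References

* S. Bravyi, D. Gosset, *Improved classical simulation of quantum circuits dominated by Clifford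
  gates*, Phys. Rev. Lett. 116 (2016) 250501, arXiv:1601.07601v3: p. 1–2 (results, eqs. (1)–(4)),
  §II (gadgetization, norm estimation), Lemma 2.
* S. Bravyi, D. Browne, P. Calpin, E. Campbell, D. Gosset, M. Howard, *Simulation of quantum
  circuits by low-rank stabilizer decompositions*, Quantum 3 (2019) 181, arXiv:1808.00128v2:
  Def. 1–3, Thm. 1, eq. (3), eq. (6), Prop. 1–2, §2.3.1 eq. (16), §5.2 (Lemma 6), §5.3.
* S. Bravyi, G. Smith, J. A. Smolin, *Trading classical and quantum computational resources*,
  Phys. Rev. X 6 (2016) 021043, arXiv:1506.01396: §I (`χ₆ ≤ 7`, `χ_n ≤ 7^{n/6}`), §IV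
  eqs. (8)–(11).
-/

noncomputable section

open Matrix Computability Literature.Computability.Complexity Literature.Algebra.EuclideanLattices

namespace Literature.Computability.QuantumComplexity

/-! ### Rank bounds -/

/-- **Sparsification bound** (Bravyi–Browne–Calpin–Campbell–Gosset–Howard 2019, Theorem 1). Let
`ψ` be a normalized `n`-qubit state with a stabilizer decomposition `ψ = ∑_{α<k} c_α φ_α`, where
the `φ_α` are normalized stabilizer states and `c_α ∈ ℂ` (the decomposition need not be optimal).
Then for every `δ > 0`, `χ_δ(ψ) ≤ 1 + ‖c‖₁² / δ²`, `‖c‖₁ = ∑_α |c_α|`.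
[cite: BravyiEtAl2019, Thm. 1] -/
def BravyiEtAl2019_thm1 : Prop :=
  ∀ {n k : ℕ} (ψ : Cryptography.QReg n → ℂ) (_hψ : Cryptography.normSq ψ = 1) (c : Fin k → ℂ) (φ : Fin k → Cryptography.QReg n → ℂ)
    (_hφ : ∀ i, φ i ∈ stabilizerStates n) (_hφ₁ : ∀ i, Cryptography.normSq (φ i) = 1)
    (_hdec : ψ = ∑ i, c i • φ i) (δ : ℝ) (_hδ : 0 < δ),
    (approxStabilizerRank δ ψ : ℝ) ≤ 1 + (∑ i, ‖c i‖) ^ 2 / δ ^ 2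

/-- **Approximate stabilizer rank of `|T⟩^{⊗m}`** (Bravyi et al. 2019; Bravyi–Gosset 2016). For
every `m` and `δ > 0`, `χ_δ(|T⟩^{⊗m}) ≤ 1 + cos(π/8)^{-2m} / δ²`: Theorem 1 applied to the
optimal-extent decomposition of `|T⟩^{⊗m}` over the `2^m` products of `|0⟩, |+⟩`-type states,
whose `‖c‖₁²` is the stabilizer extent `ξ(T^{⊗m}) = F(T^{⊗m})⁻¹ = |⟨+|T⟩|^{-2m} = cos(π/8)^{-2m}`
(§5.3 and Prop. 2); printed as eq. (6), `χ_δ(T^{⊗m}) ≤ O(δ⁻² cos(π/8)^{-2m})`, i.e.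
`O(2^{γm} δ⁻²)` with `γ = -2 log₂ cos(π/8) ≈ 0.228` (Bravyi–Gosset 2016, eq. (4)).
[cite: BravyiEtAl2019, Thm. 1, eq. (6), Prop. 2 and §5.3]
[cite: BravyiGosset2016, eq. (4)] -/
def BravyiEtAl2019_approxStabilizerRank_magicT_pow : Prop :=
  ∀ (m : ℕ) (δ : ℝ) (_hδ : 0 < δ),
    (approxStabilizerRank δ (tensorPow magicT m) : ℝ) ≤
      1 + 1 / (Real.cos (Real.pi / 8) ^ (2 * m) * δ ^ 2)

/-- **`χ(|T⟩^{⊗6}) ≤ 7`** (Bravyi–Smith–Smolin 2016, §I and the explicit seven-term decomposition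
§IV eq. (11) of `|H⟩^{⊗6}`, `|H⟩ = cos(π/8)|0⟩ + sin(π/8)|1⟩ = S H (e^{-iπ/8}|T⟩)` being
Clifford-equivalent to `|T⟩`, and `χ` being invariant under local Cliffords and nonzero
scalars). [cite: BravyiSmithSmolin2016, §I and §IV eq. (11)] -/
def BravyiSmithSmolin2016_stabilizerRank_magicT_pow_six : Prop :=
  stabilizerRank (tensorPow magicT 6) ≤ 7

/-- **`χ(|T⟩^{⊗6m}) ≤ 7^m`** (Bravyi–Smith–Smolin 2016, §I: "`χ₆ ≤ 7`, which implies
`χ_n ≤ (χ₆)^{n/6} ≤ 7^{n/6}`", via the `m`-fold tensor power §IV eq. (9) of the decomposition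
eq. (11); this is the exponent `β = (1/6) log₂ 7 ≈ 0.47` of Bravyi–Gosset 2016, p. 2).
[cite: BravyiSmithSmolin2016, §I and §IV eqs. (9), (11)] -/
def BravyiSmithSmolin2016_stabilizerRank_magicT_pow_six_mul : Prop :=
  ∀ m : ℕ, stabilizerRank (tensorPow magicT (6 * m)) ≤ 7 ^ m

/-- **Sub-multiplicativity of the stabilizer rank**: `χ(ψ ⊗ φ) ≤ χ(ψ) · χ(φ)` — the tensor
product of stabilizer decompositions is a stabilizer decomposition (Bravyi–Smith–Smolin 2016,
§IV eq. (9); Bravyi et al. 2019, §5.1). [cite: BravyiSmithSmolin2016, §IV eq. (9)] -/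
def BravyiSmithSmolin2016_stabilizerRank_tensorVec_le : Prop :=
  ∀ {a b : ℕ} (ψ : Cryptography.QReg a → ℂ) (φ : Cryptography.QReg b → ℂ),
    stabilizerRank (Cryptography.tensorVec ψ φ) ≤ stabilizerRank ψ * stabilizerRank φ

/-- **Gadgetization bound** (Bravyi–Gosset 2016, §II; Bravyi et al. 2019, §2.3.1 eq. (16)). Let
`U` be an oracle-free Clifford+`T` circuit on `N` wires with `t` `T`-gates and `|y⟩` a
computational basis state. Replacing each `T` gate by a state-injection gadget and postselecting
gives `U|y⟩ = 2^{t/2} (1 ⊗ ⟨0^t|) C (|y⟩ ⊗ |T⟩^{⊗t})` with `C` Clifford, whence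
`χ(U|y⟩) ≤ χ(|T⟩^{⊗t})` (Clifford unitaries and `⟨0|`-projections map stabilizer states to
stabilizer states or `0`). The sources take `y = 0^N`; `|y⟩ = ∏ X_i |0^N⟩` with `X = H S² H`
Clifford reduces to that case with the same `T`-count. (The oracle argument of `toMatrix` is
irrelevant for oracle-free circuits.) [cite: BravyiEtAl2019, §2.3.1 eq. (16)]
[cite: BravyiGosset2016, §II] -/
def BravyiGosset2016_stabilizerRank_output_le : Prop :=
  ∀ {N : ℕ} (U : Cryptography.QCircuit Cryptography.cliffordT N) (_hU : U.IsOracleFree) (A : Language Bool) (y : Cryptography.QReg N),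
    stabilizerRank (U.toMatrix A *ᵥ Cryptography.basisState y) ≤ stabilizerRank (tensorPow magicT U.tCount)

/-! ### The simulation problem and Bravyi–Gosset's algorithm -/

/-- An instance of the Clifford+`T` simulation problem: a circuit `circ` on `n + m` wires
(`n` input wires, `m` ancillas initialised to `0`), a classical input `x ∈ {0,1}^n`, and a
precision parameter `q` (target relative error `ε = 1/(q+1)`).
[cite: BravyiGosset2016, p. 1 (eq. (1)) and p. 2] -/
structure CliffordTInstance where
  /-- Number of input wires. -/
  n : ℕ
  /-- Number of ancilla wires. -/
  m : ℕ
  /-- The Clifford+`T` circuit on `n + m` wires. -/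
  circ : Cryptography.QCircuit Cryptography.cliffordT (n + m)
  /-- The classical input on the first `n` wires. -/
  x : Cryptography.QReg n
  /-- Precision: relative error `1/(q+1)`. -/
  q : ℕ

namespace CliffordTInstance

/-- Boolean encoding of an instance: `boolPair` of the tree's circuit description
`sigmaEncode ⟨n, m, circ⟩` (ancilla count in unary), the input bits, and `q` in **unary** (so
that "time polynomial in `1/ε`" is time polynomial in the input length).
[cite: AroraBarak2009, §0.1  §6.1 (descriptions of circuits] -/
def encode (i : CliffordTInstance) : List Bool :=
  boolPair (Cryptography.QCircuit.sigmaEncode ⟨i.n, i.m, i.circ⟩) (boolPair (List.ofFn i.x) (unaryEncodeNat i.q))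

/-- The quantity to be estimated: the wire-`0` acceptance probability `P` of `circ` run on
`|x⟩|0^m⟩` (`QCircuit.acceptProb`, oracle `0`; Bravyi–Gosset's `P_out(1)` for the output
register `Q_out = {0}`, `w = 1`). [cite: BravyiGosset2016, eq. (1)] -/
def acceptProb (i : CliffordTInstance) : ℝ :=
  i.circ.acceptProb 0 i.x

/-- The `T`-count of the instance's circuit. [cite: BravyiGosset2016, §I] -/
def tCount (i : CliffordTInstance) : ℕ :=
  i.circ.tCount

/-- The admissible running time `c · (n + m + |circ| + q + 2)^k · 2^{⌈t/2⌉}`: polynomial in the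
number of wires, the number of gates and `1/ε`, times `2^{βt}` with `β = 1/2`
(Bravyi–Gosset 2016, eq. (2) with "`β ≤ 1/2`"). [cite: BravyiGosset2016, eq. (2)] -/
def timeBound (c k : ℕ) (i : CliffordTInstance) : ℕ :=
  c * (i.n + i.m + i.circ.size + i.q + 2) ^ k * 2 ^ ((i.tCount + 1) / 2)

/-- The success event: rational outputs `r` within relative error `1/(q+1)` of `P`,
`|r - P| ≤ P/(q+1)`. [cite: BravyiGosset2016, p. 2 ("relative error `ε`")] -/
def goodEstimates (i : CliffordTInstance) : Set ℚ :=
  {r | |(r : ℝ) - i.acceptProb| ≤ i.acceptProb / (i.q + 1)}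

end CliffordTInstance

/-- **Bravyi–Gosset's Monte Carlo estimator for output probabilities of Clifford+`T` circuits**
(Bravyi–Gosset 2016, first result, p. 1–2 and eq. (2); instance `w = 1`, `p_f = 1/4`, `β = 1/2`).
There are a classical randomized algorithm `A` (a `RandAlg`, i.e. a deterministic multitape
Turing machine with a random tape) and constants `c, k` such that: `A` halts within
`c (n + m + |U| + q + 2)^k · 2^{⌈t/2⌉}` steps on every instance (`U` a Clifford+`T` circuit on
`n + m` wires with `t` `T`-gates, input `x ∈ {0,1}^n`, precision `q`), and for every oracle-free
instance it outputs, with probability at least `3/4` over its coins, a rational `p̂` with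
`|p̂ - P| ≤ P/(q+1)`, where `P` is the probability that wire `0` of `U|x 0^m⟩` reads `1`.
Printed running time: `O((w+t)(c+t) + (n+t)³ + 2^{βt} t³ ε⁻² log p_f⁻¹)`, "where `β ≤ 1/2` is a
constant that depends on the implementation details" (with the decomposition of
Bravyi–Smith–Smolin, `β = (1/6) log₂ 7`); the bound recorded here (a polynomial times
`2^{⌈t/2⌉}`) is implied by it. The input `|x 0^m⟩` instead of `|0^{n+m}⟩` costs `≤ 4n` extra
Clifford gates (`X = H S² H`). [cite: BravyiGosset2016, p. 2 eq. (2) and §II] -/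
def BravyiGosset2016_estimateAcceptProb : Prop :=
  ∃ (A : RandAlg CliffordTInstance ℚ) (c k : ℕ),
    A.RunsInTime CliffordTInstance.encode encodeRat (CliffordTInstance.timeBound c k) ∧
      ∀ i : CliffordTInstance, i.circ.IsOracleFree →
        (3 / 4 : ℝ) ≤ A.pr CliffordTInstance.encode i i.goodEstimates

/-! ### API -/

/-- `χ(|T⟩^{⊗6}) ≤ 7` is the case `m = 1` of `χ(|T⟩^{⊗6m}) ≤ 7^m`. [folklore] -/
theorem BravyiSmithSmolin2016_stabilizerRank_magicT_pow_six_mul.pow_six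
    (h : BravyiSmithSmolin2016_stabilizerRank_magicT_pow_six_mul) :
    BravyiSmithSmolin2016_stabilizerRank_magicT_pow_six := by
  show stabilizerRank (tensorPow magicT 6) ≤ 7
  simpa using h 1

/-- Sub-multiplicativity along `tensorPow`: `χ(ψ^{⊗(m+1)}) ≤ χ(ψ^{⊗m}) χ(ψ)` (the successor
power is literally `tensorVec (ψ^{⊗m}) ψ`). [folklore] -/
theorem BravyiSmithSmolin2016_stabilizerRank_tensorVec_le.tensorPow_succ
    (h : BravyiSmithSmolin2016_stabilizerRank_tensorVec_le) (ψ : Cryptography.QReg 1 → ℂ) (m : ℕ) :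
    stabilizerRank (tensorPow ψ (m + 1)) ≤ stabilizerRank (tensorPow ψ m) * stabilizerRank ψ :=
  h (tensorPow ψ m) ψ

/-- `ψ^{⊗0}` is the (stabilizer) vacuum state on zero qubits, `|0^0⟩ = 1`. [folklore] -/
theorem tensorPow_zero_eq_zeroState (ψ : Cryptography.QReg 1 → ℂ) : tensorPow ψ 0 = Cryptography.zeroState 0 := by
  funext y
  simp only [tensorPow, Cryptography.zeroState, Cryptography.basisState]
  rw [Subsingleton.elim (fun _ : Fin 0 => false) y, Pi.single_eq_same]

/-- Hence `χ(ψ^{⊗0}) ≤ 1`. [folklore] -/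
theorem stabilizerRank_tensorPow_zero_le (ψ : Cryptography.QReg 1 → ℂ) : stabilizerRank (tensorPow ψ 0) ≤ 1 := by
  rw [tensorPow_zero_eq_zeroState]
  exact stabilizerRank_le_one_of_mem (zeroState_mem_stabilizerStates 0)

/-- With the gadgetization bound, a `T`-free (Clifford) circuit applied to a basis state has
stabilizer rank `≤ 1` (its output is a stabilizer state). [folklore] -/
theorem BravyiGosset2016_stabilizerRank_output_le.of_tCount_eq_zero
    (h : BravyiGosset2016_stabilizerRank_output_le) {N : ℕ} (U : Cryptography.QCircuit Cryptography.cliffordT N)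
    (hU : U.IsOracleFree) (ht : U.tCount = 0) (A : Language Bool) (y : Cryptography.QReg N) :
    stabilizerRank (U.toMatrix A *ᵥ Cryptography.basisState y) ≤ 1 := by
  refine (h U hU A y).trans ?_
  rw [ht]
  exact stabilizerRank_tensorPow_zero_le magicT

namespace CliffordTInstance

/-- The time bound is monotone in the constants. [folklore] -/
theorem timeBound_mono {c c' k k' : ℕ} (hc : c ≤ c') (hk : k ≤ k') (i : CliffordTInstance) :
    i.timeBound c k ≤ i.timeBound c' k' := by
  unfold timeBound
  gcongr
  omega

/-- The exact value `P` (when rational) is a good estimate. [folklore] -/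
theorem mem_goodEstimates_of_eq (i : CliffordTInstance) {r : ℚ} (hr : (r : ℝ) = i.acceptProb) :
    r ∈ i.goodEstimates := by
  simp only [goodEstimates, Set.mem_setOf_eq, hr, sub_self, abs_zero]
  exact div_nonneg (Cryptography.QCircuit.acceptProb_nonneg _ _ _) (by positivity)

end CliffordTInstance

end Literature.Computability.QuantumComplexity
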